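import Summits.ResolutionOfSingularities.ResolutionOfSingularities.Theorems.PurelyInseparableDim4ScopeBlindCoat
import HarnessLib

/-!
# PARAMETRIC blind leaves by the COAT LEMMA: whole families `x_k^{q−1}·U_{β,γ,…}` are out of coordinate scope,
# uniformly in the parameters and in the field (cell `res-dim4-pi`, scope column / ∀K column)

[OURS · counted 0 · frame bookkeeping] Nothing here is a statement about resolution of singularities.
Seat res-dim4-p-8 g3 («𝔽₉ lane»).  `…ScopeBlindCoat` (p676015) proved `ScopeBlind.not_inCoordinateScope_coat`: a coat
`x_k^{q−1}·U` is blind as soon as `Ū = U(x_k ↦ 0)` is non-zero, vanishes at the origin, and is divisible by no `x_i`,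
`i ≠ k`.  These three facts are read off COEFFICIENTS, so they hold UNIFORMLY for a family `U_β` presented by a term
list whose witnessing coefficients do not depend on the parameters — the situation of the ∀K column's
«parametrised non-rational states» (res-dim4-p-14 g2, WORD #78 (c)) whenever the leaf is a coat.  This file gives the
coefficient-level entry points and two worked families:

* §1 `ne_zero_of_coeff_ne_zero'`, **`not_X_dvd_of_coeff_ne_zero`** (`coeff d P ≠ 0` with `d i = 0` forbids `x_i ∣ P`),
  `eval_zero_eq_coeff_zero'`; the term-list forms `evalT_ne_zero_of_coeffAt`, `not_X_dvd_evalT_of_coeffAt`,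
  `eval_zero_evalT_eq_coeffAt` (for lists presented with pairwise distinct exponents the constant term is `coeffAt L 0`);
* §2 **`scopeLoss_family_blind`**: for EVERY field `K` and ALL `β γ : K`, the PR-12u scope-loss leaf shape
  `x₁·(x₂ + β x₃ + γ x₄ + x₃x₄)` (`q = 2`; p-14's `scopeLossCert` children are `β, γ ∈ 𝔽₂`) is OUT of coordinate scope —
  one theorem for the whole two-parameter family, no curve per member;
* §3 **`sqrtCoat_family_blind`**: for every field `K` and ALL `β : K`, at `q = 3` the LOOP-E-type leaf `x₁²·(x₄ + β x₃ + x₂ + x₃x₄)` is OUT of coordinate scope (the linear part of the `√−1` children of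
  `…LoopELocalEscapeSqrt` has this shape with `β = i`).

OURS; counted 0.  bears_on: LADDER-RESOLUTION:D157-DOOR2 (res-dim4-pi · scope column · ∀K blindness, parametric).
Supports stmt-ResolutionOfSingularities-16155 (helper).
-/

set_option linter.dupNamespace false -- mandated namespace of this single-conjunct summit

noncomputable section

open MvPolynomial Finset
open scoped BigOperators

namespace Summit.ResolutionOfSingularities.ResolutionOfSingularities.Theorems.PIDim4

namespace ScopeBlind

open Literature.AlgebraicGeometry.Resolution
open StepKit

variable {K : Type} [Field K]

/-! ## §1 Coefficient-level entry points -/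

/-- a polynomial with a non-zero coefficient is non-zero. [folklore] -/
theorem ne_zero_of_coeff_ne_zero' {P : MvPolynomial (Fin 4) K} {d : Fin 4 →₀ ℕ} (h : coeff d P ≠ 0) : P ≠ 0 :=
  fun hP => h (by rw [hP, coeff_zero])

/-- **a non-zero coefficient at an exponent with `d_i = 0` forbids `x_i ∣ P`.** [folklore] -/
theorem not_X_dvd_of_coeff_ne_zero {P : MvPolynomial (Fin 4) K} {d : Fin 4 →₀ ℕ} {i : Fin 4} (hd : d i = 0)
    (h : coeff d P ≠ 0) : ¬ ((X i : MvPolynomial (Fin 4) K) ∣ P) := by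
  classical
  rintro ⟨Q, rfl⟩
  rw [coeff_X_mul', if_neg (by rw [Finsupp.mem_support_iff, not_not]; exact hd)] at h
  exact h rfl

/-- the value at the origin is the constant coefficient. [folklore] -/
theorem eval_zero_eq_coeff_zero' (P : MvPolynomial (Fin 4) K) :
    MvPolynomial.eval (0 : Fin 4 → K) P = coeff 0 P := by
  rw [← constantCoeff_eq, ← MvPolynomial.eval_zero]

/-- term-list form: a non-zero `coeffAt` makes `evalT L ≠ 0`. [folklore] -/
theorem evalT_ne_zero_of_coeffAt {L : Terms 4 K} {e : Fin 4 → ℕ} (h : coeffAt L e ≠ 0) : evalT L ≠ 0 :=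
  ne_zero_of_coeff_ne_zero' (d := expo e) (by rwa [coeff_expo_evalT])

/-- term-list form: `coeffAt L e ≠ 0` with `e i = 0` forbids `x_i ∣ evalT L`. [folklore] -/
theorem not_X_dvd_evalT_of_coeffAt {L : Terms 4 K} {e : Fin 4 → ℕ} {i : Fin 4} (hei : e i = 0)
    (h : coeffAt L e ≠ 0) : ¬ ((X i : MvPolynomial (Fin 4) K) ∣ evalT L) :=
  not_X_dvd_of_coeff_ne_zero (d := expo e) hei (by rwa [coeff_expo_evalT])

/-- term-list form: the value of `evalT L` at the origin is `coeffAt L 0`. [folklore] -/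
theorem eval_zero_evalT_eq_coeffAt (L : Terms 4 K) :
    MvPolynomial.eval (0 : Fin 4 → K) (evalT L) = coeffAt L 0 := by
  rw [eval_zero_eq_coeff_zero', ← coeff_expo_evalT, (expo_eq_zero_iff _).mpr rfl]

/-- **the coat lemma on a presented `U`**: `U = evalT LU`, the `x_k`-free part `Ū = evalT (LU.filter (·.1 k = 0))`;
blindness from three COEFFICIENT facts about the filtered list — non-vanishing of one coefficient, vanishing of the
constant coefficient, and for each `i ≠ k` a non-zero coefficient at an exponent with `e_i = 0`.  The coefficients may be
symbolic. [folklore] -/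
theorem not_inCoordinateScope_coat_evalT {q : ℕ} (hq : 2 ≤ q) (k : Fin 4) (LU : Terms 4 K) {e₀ : Fin 4 → ℕ}
    (hne : coeffAt (LU.filter fun t => t.1 k = 0) e₀ ≠ 0) (h0 : coeffAt (LU.filter fun t => t.1 k = 0) 0 = 0)
    (hX : ∀ i : Fin 4, i ≠ k → ∃ e : Fin 4 → ℕ, e i = 0 ∧ coeffAt (LU.filter fun t => t.1 k = 0) e ≠ 0) :
    ¬ InCoordinateScope q ((X k : MvPolynomial (Fin 4) K) ^ (q - 1) * evalT LU) := by
  classical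
  refine not_inCoordinateScope_coat hq k (evalT LU) ?_ ?_ ?_
  · rw [aeval_kill_evalT]
    exact evalT_ne_zero_of_coeffAt hne
  · rw [← eval_zero_aeval_kill k, aeval_kill_evalT, eval_zero_evalT_eq_coeffAt, h0]
  · intro i hik
    obtain ⟨e, hei, he⟩ := hX i hik
    rw [aeval_kill_evalT]
    exact not_X_dvd_evalT_of_coeffAt hei he

/-! ## §2 The scope-loss family (`q = 2`, every field, all parameters) -/

/-- the family `U_{β,γ} = x₂ + β x₃ + γ x₄ + x₃x₄` as a term list with symbolic coefficients. -/
theorem evalT_scopeLossU (β γ : K) :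
    evalT ([(![0, 1, 0, 0], 1), (![0, 0, 1, 0], β), (![0, 0, 0, 1], γ), (![0, 0, 1, 1], 1)] : Terms 4 K) =
      X 1 + C β * X 2 + C γ * X 3 + X 2 * X 3 := by
  simp only [evalT_cons, evalT_nil, monomial_expo_eq, Fin.prod_univ_four, add_zero]
  simp
  ring

/-- **THE SCOPE-LOSS FAMILY IS BLIND FOR ALL PARAMETERS OVER EVERY FIELD**: for every field `K` and all `β γ : K`,
`x₁·(x₂ + β x₃ + γ x₄ + x₃x₄)` is OUT of coordinate scope at `q = 2` (res-dim4-p-14's PR-12u scope-loss children are the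
members `β, γ ∈ 𝔽₂`; here one theorem, no curve, no case split). [OURS · coat lemma instance] -/
theorem scopeLoss_family_blind (β γ : K) :
    ¬ InCoordinateScope 2 ((X 0 : MvPolynomial (Fin 4) K) * (X 1 + C β * X 2 + C γ * X 3 + X 2 * X 3)) := by
  classical
  have h := not_inCoordinateScope_coat_evalT (K := K) (q := 2) le_rfl 0
    ([(![0, 1, 0, 0], 1), (![0, 0, 1, 0], β), (![0, 0, 0, 1], γ), (![0, 0, 1, 1], 1)] : Terms 4 K) (e₀ := ![0, 1, 0, 0])
    (by simp [coeffAt]) (by simp [coeffAt]) (by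
      intro i hi
      fin_cases i
      · exact absurd rfl hi
      · exact ⟨![0, 0, 1, 1], rfl, by simp [coeffAt]⟩
      · exact ⟨![0, 1, 0, 0], rfl, by simp [coeffAt]⟩
      · exact ⟨![0, 1, 0, 0], rfl, by simp [coeffAt]⟩)
  rwa [evalT_scopeLossU, pow_one] at h

/-! ## §3 A `q = 3` family: the `√−1`-type coat `x₁²·(x₄ + β x₃ + x₂ + x₃x₄)` -/

/-- the family `x₄ + β x₃ + x₂ + x₃x₄` as a term list. -/
theorem evalT_sqrtU (β : K) :
    evalT ([(![0, 0, 0, 1], 1), (![0, 0, 1, 0], β), (![0, 1, 0, 0], 1), (![0, 0, 1, 1], 1)] : Terms 4 K) =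
      X 3 + C β * X 2 + X 1 + X 2 * X 3 := by
  simp only [evalT_cons, evalT_nil, monomial_expo_eq, Fin.prod_univ_four, add_zero]
  simp
  ring

/-- **for every field `K` and every `β : K`, `x₁²·(x₄ + β x₃ + x₂ + x₃x₄)` is OUT of coordinate scope at `q = 3`** — the
shape of the linear part of LOOP-E's `√−1` children (there `β = i`), uniformly in `β`. [OURS · coat lemma instance] -/
theorem sqrtCoat_family_blind (β : K) :
    ¬ InCoordinateScope 3 ((X 0 : MvPolynomial (Fin 4) K) ^ 2 * (X 3 + C β * X 2 + X 1 + X 2 * X 3)) := by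
  classical
  have h := not_inCoordinateScope_coat_evalT (K := K) (q := 3) (by norm_num) 0
    ([(![0, 0, 0, 1], 1), (![0, 0, 1, 0], β), (![0, 1, 0, 0], 1), (![0, 0, 1, 1], 1)] : Terms 4 K) (e₀ := ![0, 0, 0, 1])
    (by simp [coeffAt]) (by simp [coeffAt]) (by
      intro i hi
      fin_cases i
      · exact absurd rfl hi
      · exact ⟨![0, 0, 0, 1], rfl, by simp [coeffAt]⟩
      · exact ⟨![0, 0, 0, 1], rfl, by simp [coeffAt]⟩
      · exact ⟨![0, 1, 0, 0], rfl, by simp [coeffAt]⟩)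
  rwa [evalT_sqrtU] at h

end ScopeBlind

end Summit.ResolutionOfSingularities.ResolutionOfSingularities.Theorems.PIDim4

end
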